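import Mathlib
import HarnessLib
import Summits.HubbardSuperconductivity.HubbardSuperconductivity.Theorems.KLProgrammeFermiSurfaceTwoLoopCaustic
import Summits.HubbardSuperconductivity.HubbardSuperconductivity.Theorems.KLProgrammeFermiSurfaceTwoLoopDyadic
import Summits.HubbardSuperconductivity.HubbardSuperconductivity.Theorems.KLProgrammeKLRegimeTwoPointLimitShellAngularBound
import Summits.HubbardSuperconductivity.HubbardSuperconductivity.Theorems.KLProgrammeKLRegimeTwoPointLimitShellAngularBoundAway
import Summits.HubbardSuperconductivity.HubbardSuperconductivity.Theorems.KLProgrammeKLRegimeTwoPointLimitShellAngularBoundCaustic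

/-!
# Route `KLProgramme` (cruxes K3/K1, risk r2) — FST II Theorem 1.1 (two-loop volume) for the Hubbard band, part 6:
# the iterated ANGULAR two-loop bound `∫dθ₁ |{θ₂ : |ε₂(p_μ(θ₂) - (τp_μ(θ₁) + q)) - μ| ≤ ε}| ≤ Q ε |log ε|`

Cell `gate-hubbard-kl`, seat fs-1 (g5), risk-register item r2; the analytic assembly of the series
`KLProgrammeFermiSurfaceTwoLoop{Level, Window, Caustic, Polar, Dyadic}.lean` (programme described in `…TwoLoopLevel.lean`).
For a compact level range `[a, b] ⊂ (-4, 0)`, `kltl_exists_angular_bound` gives ONE `Q` with, for every `μ ∈ [a, b]`,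
sign `τ = ±1`, shift `q ∈ ℝ²`, period `[θ₀, θ₀ + 2π]` and `0 < ε ≤ 1/2`,
`∫_{θ₁} vol{θ₂ : |ε₂(X(θ₂) - (τX(θ₁) + q₁), Y(θ₂) - (τY(θ₁) + q₂)) - μ| ≤ ε} dθ₁ ≤ Q ε |log ε|`.
Ingredients, at transfer `w(θ₁) = τ p_μ(θ₁) + q`: p1b's inner laws on the enlarged range `[a - η, b + η]`
(`klan_exists_cooper_bound`: `C δ/|w|_∞` for `0 < |w|_∞ ≤ v`; `klan_exists_away_bound`: `C₁δ + C₂√δ` when every lattice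
translate of `w` has `|·|_∞ ≥ v'`; `klan_exists_caustic_refined`: `C₁δ + C₃δ/√r` when moreover `w` is at sup-distance
`≥ r ≥ c₀δ` from `2S_μ + 2πℤ²`), the outer estimates `kltl_volume_nearPoint_le` (Cooper side `≤ 4π√2 s/u_min`,
`s < π - K`, whence `v' = min(v, (π - K_{b+η})/2)`) and `kltl_exists_volume_nearCaustic_le` (caustic side `≤ D√s`), and
the two dyadic lemmas `kltl_dyadic_cooper` / `kltl_dyadic_caustic` with `J = ⌈log(v'/ε)/log 2⌉₊`,
`J' = ⌊log(1/(c₀ε))/log 2⌋₊` scales (`kltl_cooper_scales`, `kltl_caustic_scales`: `J, J' ≤ κ|log ε|`). For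
`ε` above the threshold `εs = min(δ's, 1, 1/c₀)` the trivial bound `4π²` is absorbed using `|log ε| ≥ log 2`.
No definitions; everything PROVED; constants existential. [folklore]
-/

noncomputable section

open Real Set MeasureTheory
open scoped ENNReal

-- the tree's namespace `Summit.<Summit>.<Problem>.Theorems` repeats the summit name by design (D-0017)
set_option linter.dupNamespace false

namespace Summit.HubbardSuperconductivity.HubbardSuperconductivity.Theorems

open Literature.MathematicalPhysics.QuantumLattice
open Literature.MathematicalPhysics.QuantumLattice.BandSectorCounting

/-! ### Counting the dyadic scales -/

/-- `|log ε| ≥ log 2` for `0 < ε ≤ 1/2`. [folklore] -/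
theorem kltl_log_two_le_abs_log {ε : ℝ} (hε : 0 < ε) (hε2 : ε ≤ 1 / 2) : Real.log 2 ≤ |Real.log ε| := by
  have h1 : Real.log ε ≤ Real.log (1 / 2) := Real.log_le_log hε hε2
  have h2 : Real.log (1 / 2 : ℝ) = -Real.log 2 := by rw [one_div, Real.log_inv]
  have h3 : 0 < Real.log 2 := Real.log_pos one_lt_two
  rw [h2] at h1
  have : Real.log ε < 0 := by linarith
  rw [abs_of_neg this]; linarith

/-- The number of Cooper scales: `J = ⌈log(v/ε)/log 2⌉₊` has `2^J ≥ v/ε` and `J ≤ κ |log ε|`,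
`κ = (|log v| + 2 log 2)/(log 2)²`, when `|log ε| ≥ log 2`. [folklore] -/
theorem kltl_cooper_scales {v ε : ℝ} (hv : 0 < v) (hε : 0 < ε) (hL : Real.log 2 ≤ |Real.log ε|) :
    v / 2 ^ ⌈Real.log (v / ε) / Real.log 2⌉₊ ≤ ε ∧
      (⌈Real.log (v / ε) / Real.log 2⌉₊ : ℝ) ≤ (|Real.log v| + 2 * Real.log 2) / Real.log 2 ^ 2 * |Real.log ε| := by
  have hl : 0 < Real.log 2 := Real.log_pos one_lt_two
  set x : ℝ := Real.log (v / ε) / Real.log 2 with hx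
  set J : ℕ := ⌈x⌉₊ with hJ
  have hpow : 0 < (2 : ℝ) ^ J := by positivity
  constructor
  · -- `v/ε ≤ 2^J`
    rw [div_le_iff₀ hpow]
    have hxJ : x ≤ J := Nat.le_ceil x
    have h1 : Real.log (v / ε) ≤ Real.log ((2 : ℝ) ^ J) := by
      rw [Real.log_pow]; rw [hx, div_le_iff₀ hl] at hxJ; linarith
    have h2 := (Real.log_le_log_iff (div_pos hv hε) hpow).1 h1
    rw [div_le_iff₀ hε] at h2; linarith
  · have hxle : x ≤ (|Real.log v| + |Real.log ε|) / Real.log 2 := by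
      rw [hx, Real.log_div hv.ne' hε.ne']
      exact div_le_div_of_nonneg_right (by linarith [le_abs_self (Real.log v), neg_abs_le (Real.log ε)]) hl.le
    have hJle : (J : ℝ) ≤ (|Real.log v| + |Real.log ε|) / Real.log 2 + 1 := by
      rcases le_or_gt x 0 with h0 | h0
      · have : J = 0 := Nat.ceil_eq_zero.2 h0
        rw [this]; push_cast; positivity
      · have := Nat.ceil_lt_add_one h0.le
        linarith
    refine hJle.trans ?_
    rw [div_mul_eq_mul_div, le_div_iff₀ (by positivity)]
    have e : ((|Real.log v| + |Real.log ε|) / Real.log 2 + 1) * Real.log 2 ^ 2 =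
        (|Real.log v| + |Real.log ε|) * Real.log 2 + Real.log 2 ^ 2 := by
      field_simp
    rw [e]
    have hv0 := abs_nonneg (Real.log v)
    nlinarith

/-- The number of caustic scales: `J' = ⌊log(1/(c₀ε))/log 2⌋₊` has `c₀ε ≤ 1/2^{J'} < 2c₀ε` and
`J' ≤ κ' |log ε|`, `κ' = (|log c₀| + log 2)/(log 2)²`, when `c₀ ε ≤ 1` and `|log ε| ≥ log 2`. [folklore] -/
theorem kltl_caustic_scales {c₀ ε : ℝ} (hc₀ : 0 < c₀) (hε : 0 < ε) (hcε : c₀ * ε ≤ 1) (hL : Real.log 2 ≤ |Real.log ε|) :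
    c₀ * ε ≤ 1 / 2 ^ ⌊Real.log (1 / (c₀ * ε)) / Real.log 2⌋₊ ∧
      1 / 2 ^ ⌊Real.log (1 / (c₀ * ε)) / Real.log 2⌋₊ < 2 * (c₀ * ε) ∧
      (⌊Real.log (1 / (c₀ * ε)) / Real.log 2⌋₊ : ℝ) ≤ (|Real.log c₀| + Real.log 2) / Real.log 2 ^ 2 * |Real.log ε| := by
  have hl : 0 < Real.log 2 := Real.log_pos one_lt_two
  have hcε0 : 0 < c₀ * ε := mul_pos hc₀ hε
  set y : ℝ := Real.log (1 / (c₀ * ε)) / Real.log 2 with hy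
  have hy0 : 0 ≤ y := div_nonneg (Real.log_nonneg (by rw [le_div_iff₀ hcε0]; linarith)) hl.le
  set J : ℕ := ⌊y⌋₊ with hJ
  have hpow : 0 < (2 : ℝ) ^ J := by positivity
  refine ⟨?_, ?_, ?_⟩
  · -- `2^J ≤ 1/(c₀ε)`
    rw [le_div_iff₀ hpow]
    have hJy : (J : ℝ) ≤ y := Nat.floor_le hy0
    have h1 : Real.log ((2 : ℝ) ^ J) ≤ Real.log (1 / (c₀ * ε)) := by
      rw [Real.log_pow]; rw [hy, le_div_iff₀ hl] at hJy; linarith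
    have h2 := (Real.log_le_log_iff hpow (by positivity)).1 h1
    rw [le_div_iff₀ hcε0] at h2; linarith
  · -- `1/(c₀ε) < 2^(J+1)`
    have hJy : y < J + 1 := Nat.lt_floor_add_one y
    have h1 : Real.log (1 / (c₀ * ε)) < Real.log ((2 : ℝ) ^ (J + 1)) := by
      rw [Real.log_pow]; rw [hy, div_lt_iff₀ hl] at hJy; push_cast; linarith
    have h2 := (Real.log_lt_log_iff (by positivity) (by positivity)).1 h1
    rw [div_lt_iff₀ hcε0, pow_succ] at h2
    rw [div_lt_iff₀ hpow]; linarith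
  · have hJy : (J : ℝ) ≤ y := Nat.floor_le hy0
    have hyle : y ≤ (|Real.log c₀| + |Real.log ε|) / Real.log 2 := by
      rw [hy, one_div, Real.log_inv, Real.log_mul hc₀.ne' hε.ne']
      exact div_le_div_of_nonneg_right (by linarith [neg_abs_le (Real.log c₀), neg_abs_le (Real.log ε)]) hl.le
    refine (hJy.trans hyle).trans ?_
    rw [div_mul_eq_mul_div, le_div_iff₀ (by positivity)]
    have e : (|Real.log c₀| + |Real.log ε|) / Real.log 2 * Real.log 2 ^ 2 =
        (|Real.log c₀| + |Real.log ε|) * Real.log 2 := by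
      field_simp
    rw [e]
    have := abs_nonneg (Real.log c₀)
    nlinarith

/-! ### The angular two-loop bound -/

section Angular

variable {a b : ℝ} (ha : -4 < a) (hab : a ≤ b) (hb : b < 0)
include ha hab hb

/-- **The iterated angular two-loop bound.** There is `Q` such that for every `μ ∈ [a, b]`, every sign `τ = ±1`,
every shift `q ∈ ℝ²`, every period `[θ₀, θ₀ + 2π]` and every `0 < ε ≤ 1/2`:
`∫_{θ₁} vol{θ₂ : |ε₂(p_μ(θ₂) - (τ p_μ(θ₁) + q)) - μ| ≤ ε} dθ₁ ≤ Q ε |log ε|`. [folklore] -/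
theorem kltl_exists_angular_bound :
    ∃ Q : ℝ, 0 < Q ∧ ∀ μ ∈ Icc a b, ∀ τ : ℝ, (τ = 1 ∨ τ = -1) → ∀ q₁ q₂ θ₀ ε : ℝ, 0 < ε → ε ≤ 1 / 2 →
      ∫⁻ θ₁ in Icc θ₀ (θ₀ + 2 * π), volume {θ₂ ∈ Icc θ₀ (θ₀ + 2 * π) |
          |eps2 (bandX μ θ₂ - (τ * bandX μ θ₁ + q₁)) (bandY μ θ₂ - (τ * bandY μ θ₁ + q₂)) - μ| ≤ ε} ≤
        ENNReal.ofReal (Q * ε * |Real.log ε|) := by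
  have hπ := Real.pi_pos
  have hl : 0 < Real.log 2 := Real.log_pos one_lt_two
  -- the enlarged level range on which p1b's inner laws are invoked
  obtain ⟨η, hη⟩ : ∃ η : ℝ, η = min (a + 4) (-b) / 2 := ⟨_, rfl⟩
  have hη0 : 0 < η := by rw [hη]; exact div_pos (lt_min (by linarith) (by linarith)) two_pos
  have hηa : η ≤ (a + 4) / 2 := by rw [hη]; linarith [min_le_left (a + 4) (-b)]
  have hηb : η ≤ -b / 2 := by rw [hη]; linarith [min_le_right (a + 4) (-b)]
  have ha₀ : -4 < a - η := by linarith
  have hb₀ : b + η < 0 := by linarith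
  have hab₀ : a - η ≤ b + η := by linarith
  set B : BandBounds (a - η) (b + η) := bandBounds ha₀ hab₀ hb₀ with hB
  have hu := B.umin_pos
  -- p1b's inner laws and the outer estimates
  obtain ⟨v, δc, Cc, hv, hδc, hCc, hcoop⟩ := klan_exists_cooper_bound B hη0
  have hKb : umklappRadius (b + η) < π := umklappRadius_lt_pi hb₀
  obtain ⟨v', hv'⟩ : ∃ v' : ℝ, v' = min v ((π - umklappRadius (b + η)) / 2) := ⟨_, rfl⟩
  have hv'0 : 0 < v' := by rw [hv']; exact lt_min hv (by linarith)
  have hv'v : v' ≤ v := by rw [hv']; exact min_le_left _ _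
  have hv'K : v' < π - umklappRadius (b + η) := by
    rw [hv']; linarith [min_le_right v ((π - umklappRadius (b + η)) / 2)]
  obtain ⟨δa, Ca₁, Ca₂, hδa, hCa₁, hCa₂, haway⟩ := klan_exists_away_bound B hη0 hv'0
  obtain ⟨δr, c₀, Cr₁, Cr₃, hδr, hc₀, hCr₁, hCr₃, hrefined⟩ := klan_exists_caustic_refined B hη0 hv'0
  obtain ⟨DK, hDK, hcaus⟩ := kltl_exists_volume_nearCaustic_le ha hab hb
  -- constants
  obtain ⟨K₁, hK₁⟩ : ∃ K₁ : ℝ, K₁ = 4 * π * Real.sqrt 2 / B.umin := ⟨_, rfl⟩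
  have hK₁0 : 0 < K₁ := by rw [hK₁]; positivity
  obtain ⟨εs, hεs⟩ : ∃ εs : ℝ, εs = min (min (min δc δa) (min δr 1)) (1 / c₀) := ⟨_, rfl⟩
  have hεs0 : 0 < εs := by rw [hεs]; positivity
  have hεs_c : εs ≤ δc := by rw [hεs]; exact (min_le_left _ _).trans ((min_le_left _ _).trans (min_le_left _ _))
  have hεs_a : εs ≤ δa := by rw [hεs]; exact (min_le_left _ _).trans ((min_le_left _ _).trans (min_le_right _ _))
  have hεs_r : εs ≤ δr := by rw [hεs]; exact (min_le_left _ _).trans ((min_le_right _ _).trans (min_le_left _ _))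
  have hεs_1 : εs ≤ 1 := by rw [hεs]; exact (min_le_left _ _).trans ((min_le_right _ _).trans (min_le_right _ _))
  have hεs_c₀ : εs ≤ 1 / c₀ := by rw [hεs]; exact min_le_right _ _
  obtain ⟨κJ, hκJ⟩ : ∃ κ : ℝ, κ = (|Real.log v'| + 2 * Real.log 2) / Real.log 2 ^ 2 := ⟨_, rfl⟩
  obtain ⟨κJ', hκJ'⟩ : ∃ κ : ℝ, κ = (|Real.log c₀| + Real.log 2) / Real.log 2 ^ 2 := ⟨_, rfl⟩
  have hκJ0 : 0 ≤ κJ := by rw [hκJ]; positivity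
  have hκJ'0 : 0 ≤ κJ' := by rw [hκJ']; positivity
  obtain ⟨Q₁, hQ₁⟩ : ∃ Q : ℝ, Q = 2 * K₁ * Cc * κJ + DK * (Cr₁ + Cr₃ * Real.sqrt 2) * κJ' +
      (2 * π * K₁ + 2 * π * (Cr₁ + Cr₃) + DK * Real.sqrt (2 * c₀) * (Ca₁ + Ca₂)) / Real.log 2 := ⟨_, rfl⟩
  have hQ₁0 : 0 ≤ Q₁ := by rw [hQ₁]; positivity
  obtain ⟨Q₂, hQ₂⟩ : ∃ Q : ℝ, Q = 4 * π ^ 2 / (εs * Real.log 2) := ⟨_, rfl⟩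
  have hQ₂0 : 0 < Q₂ := by rw [hQ₂]; positivity
  refine ⟨Q₁ + Q₂, by positivity, fun μ hμ τ hτ q₁ q₂ θ₀ ε hε hε2 => ?_⟩
  have hμ₁ : -4 < μ := ha.trans_le hμ.1
  have hμ₂ : μ < 0 := hμ.2.trans_lt hb
  have hμlo : a - η ≤ μ - η := by linarith [hμ.1]
  have hμhi : μ + η ≤ b + η := by linarith [hμ.2]
  have hμB : μ ∈ Icc (a - η) (b + η) := ⟨by linarith [hμ.1], by linarith [hμ.2]⟩
  have hL := kltl_log_two_le_abs_log hε hε2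
  set L : ℝ := |Real.log ε| with hLdef
  have hL0 : 0 < L := hl.trans_le hL
  -- the integrand and the two families of outer sets
  obtain ⟨f, hf⟩ : ∃ f : ℝ → ℝ≥0∞, ∀ θ₁, f θ₁ = volume {θ₂ ∈ Icc θ₀ (θ₀ + 2 * π) |
      |eps2 (bandX μ θ₂ - (τ * bandX μ θ₁ + q₁)) (bandY μ θ₂ - (τ * bandY μ θ₁ + q₂)) - μ| ≤ ε} :=
    ⟨_, fun _ => rfl⟩
  have hgoal : (∫⁻ θ₁ in Icc θ₀ (θ₀ + 2 * π), volume {θ₂ ∈ Icc θ₀ (θ₀ + 2 * π) |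
      |eps2 (bandX μ θ₂ - (τ * bandX μ θ₁ + q₁)) (bandY μ θ₂ - (τ * bandY μ θ₁ + q₂)) - μ| ≤ ε}) =
      ∫⁻ θ₁ in Icc θ₀ (θ₀ + 2 * π), f θ₁ := by simp only [hf]
  rw [hgoal]
  have hfA : ∀ θ, f θ ≤ ENNReal.ofReal (2 * π) := fun θ => by
    rw [hf]; exact klan_volume_sublevel_le_two_pi μ _ _ ε θ₀
  have hvolI : volume (Icc θ₀ (θ₀ + 2 * π)) = ENNReal.ofReal (2 * π) := by
    rw [Real.volume_Icc]; congr 1; ring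
  rcases lt_or_ge εs ε with hlarge | hsmall
  · -- large `ε`: the trivial bound `4π²`
    have h1 : ∫⁻ θ₁ in Icc θ₀ (θ₀ + 2 * π), f θ₁ ≤ ENNReal.ofReal (2 * π) * ENNReal.ofReal (2 * π) := by
      calc ∫⁻ θ₁ in Icc θ₀ (θ₀ + 2 * π), f θ₁ ≤ ENNReal.ofReal (2 * π) * volume (Icc θ₀ (θ₀ + 2 * π)) :=
            kltl_setLIntegral_le_const_mul fun θ _ => hfA θ
        _ = ENNReal.ofReal (2 * π) * ENNReal.ofReal (2 * π) := by rw [hvolI]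
    refine h1.trans ?_
    rw [← ENNReal.ofReal_mul (by positivity)]
    apply ENNReal.ofReal_le_ofReal
    have h2 : 2 * π * (2 * π) = Q₂ * (εs * Real.log 2) := by rw [hQ₂]; field_simp; ring
    rw [h2]
    have h3 : εs * Real.log 2 ≤ ε * L := mul_le_mul hlarge.le hL hl.le hε.le
    have h4 : Q₂ * (εs * Real.log 2) ≤ Q₂ * (ε * L) := mul_le_mul_of_nonneg_left h3 hQ₂0.le
    have h5 : (Q₁ + Q₂) * ε * L = Q₁ * ε * L + Q₂ * (ε * L) := by ring
    have h6 : 0 ≤ Q₁ * ε * L := by positivity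
    rw [h5]; linarith
  -- small `ε`
  have hεc : ε ≤ δc := hsmall.trans hεs_c
  have hεa : ε ≤ δa := hsmall.trans hεs_a
  have hεr : ε ≤ δr := hsmall.trans hεs_r
  have hε1 : ε ≤ 1 := hsmall.trans hεs_1
  have hcε : c₀ * ε ≤ 1 := by
    have := hsmall.trans hεs_c₀; rw [le_div_iff₀ hc₀] at this; linarith
  obtain ⟨C, hC⟩ : ∃ C : ℝ → Set ℝ, ∀ s, C s = {θ | ∃ m₀ m₁ : ℤ,
      max |τ * bandX μ θ + q₁ - m₀ * (2 * π)| |τ * bandY μ θ + q₂ - m₁ * (2 * π)| < s} := ⟨_, fun _ => rfl⟩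
  obtain ⟨K, hK⟩ : ∃ K : ℝ → Set ℝ, ∀ s, K s = {θ | ∃ m₀ m₁ : ℤ, ∃ φ : ℝ,
      max |τ * bandX μ θ + q₁ - m₀ * (2 * π) - 2 * bandX μ φ| |τ * bandY μ θ + q₂ - m₁ * (2 * π) - 2 * bandY μ φ| < s} :=
    ⟨_, fun _ => rfl⟩
  -- Cooper part
  have hvolC : ∀ s, 0 < s → s ≤ v' → volume (Icc θ₀ (θ₀ + 2 * π) ∩ C s) ≤ ENNReal.ofReal (K₁ * s) := by
    intro s hs hsv
    have h := kltl_volume_nearPoint_le B hμB hτ q₁ q₂ θ₀ hs (hsv.trans_lt hv'K)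
    rw [hC]
    refine (le_of_eq ?_).trans (h.trans (le_of_eq ?_))
    · rfl
    · rw [hK₁]; congr 1; ring
  have hfC : ∀ s, 0 < s → s ≤ v' → ∀ θ ∈ C s, θ ∉ C (s / 2) → f θ ≤ ENNReal.ofReal (2 * Cc * ε / s) := by
    intro s hs hsv θ hθ hθn
    rw [hC] at hθ hθn
    obtain ⟨m₀, m₁, hlt⟩ := hθ
    have hge : s / 2 ≤ max |τ * bandX μ θ + q₁ - m₀ * (2 * π)| |τ * bandY μ θ + q₂ - m₁ * (2 * π)| := by
      by_contra h
      exact hθn ⟨m₀, m₁, lt_of_not_ge h⟩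
    have hpos : 0 < max |τ * bandX μ θ + q₁ - m₀ * (2 * π)| |τ * bandY μ θ + q₂ - m₁ * (2 * π)| := by linarith
    rw [hf, ← klan_sublevel_eq_of_sub_int_mul μ (τ * bandX μ θ + q₁) (τ * bandY μ θ + q₂) ε _ m₀ m₁]
    refine (hcoop μ hμlo hμhi ε _ _ θ₀ hε hεc hpos (by linarith)).trans (ENNReal.ofReal_le_ofReal ?_)
    calc Cc * ε / max |τ * bandX μ θ + q₁ - m₀ * (2 * π)| |τ * bandY μ θ + q₂ - m₁ * (2 * π)|
        ≤ Cc * ε / (s / 2) := div_le_div_of_nonneg_left (by positivity) (by positivity) hge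
      _ = 2 * Cc * ε / s := by field_simp
  obtain ⟨hJε, hJle⟩ := kltl_cooper_scales hv'0 hε hL
  set J : ℕ := ⌈Real.log (v' / ε) / Real.log 2⌉₊ with hJ
  have hcoopInt := kltl_dyadic_cooper (I := Icc θ₀ (θ₀ + 2 * π)) (C := C) (f := f) hv'0 hK₁0.le
    (by positivity : (0 : ℝ) ≤ 2 * Cc) hε.le (by positivity : (0 : ℝ) ≤ 2 * π) hvolC hfC hfA J
  -- caustic part, on `A = I \ C v'`
  have hvolA : volume (Icc θ₀ (θ₀ + 2 * π) \ C v') ≤ ENNReal.ofReal (2 * π) := by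
    rw [← hvolI]; exact measure_mono fun θ hθ => hθ.1
  have hvolK : ∀ s, 0 < s → volume ((Icc θ₀ (θ₀ + 2 * π) \ C v') ∩ K s) ≤ ENNReal.ofReal (DK * Real.sqrt s) := by
    intro s hs
    have h := hcaus μ hμ τ hτ q₁ q₂ θ₀ s hs
    refine (measure_mono ?_).trans h
    rintro θ ⟨⟨hθI, -⟩, hθK⟩
    rw [hK] at hθK
    exact ⟨hθI, hθK⟩
  have htrans : ∀ θ, θ ∉ C v' → ∀ m₀ m₁ : ℤ,
      v' ≤ max |τ * bandX μ θ + q₁ - m₀ * (2 * π)| |τ * bandY μ θ + q₂ - m₁ * (2 * π)| := by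
    intro θ hθ m₀ m₁
    rw [hC] at hθ
    by_contra h
    exact hθ ⟨m₀, m₁, lt_of_not_ge h⟩
  have hfK : ∀ s, c₀ * ε ≤ s → ∀ θ ∈ Icc θ₀ (θ₀ + 2 * π) \ C v', θ ∉ K s →
      f θ ≤ ENNReal.ofReal (Cr₁ * ε + Cr₃ * ε / Real.sqrt s) := by
    rintro s hs θ ⟨-, hθC⟩ hθK
    rw [hK] at hθK
    have hfar : ∀ (m₀ m₁ : ℤ) (φ : ℝ), s ≤ max |τ * bandX μ θ + q₁ - m₀ * (2 * π) - 2 * bandX μ φ|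
        |τ * bandY μ θ + q₂ - m₁ * (2 * π) - 2 * bandY μ φ| := by
      intro m₀ m₁ φ; by_contra h; exact hθK ⟨m₀, m₁, φ, lt_of_not_ge h⟩
    rw [hf]
    exact hrefined μ hμlo hμhi ε _ _ θ₀ s hε hεr (htrans θ hθC) hs hfar
  have hfM : ∀ θ ∈ Icc θ₀ (θ₀ + 2 * π) \ C v', f θ ≤ ENNReal.ofReal (Ca₁ * ε + Ca₂ * Real.sqrt ε) := by
    rintro θ ⟨-, hθC⟩
    rw [hf]
    exact haway μ hμlo hμhi ε _ _ θ₀ hε hεa (htrans θ hθC)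
  obtain ⟨hJ'lo, hJ'hi, hJ'le⟩ := kltl_caustic_scales hc₀ hε hcε hL
  set J' : ℕ := ⌊Real.log (1 / (c₀ * ε)) / Real.log 2⌋₊ with hJ'
  have hM0 : 0 ≤ Ca₁ * ε + Ca₂ * Real.sqrt ε := by positivity
  have hcausInt := kltl_dyadic_caustic (A := Icc θ₀ (θ₀ + 2 * π) \ C v') (K := K) (f := f) (r₀ := 1)
    (s₁ := c₀ * ε) one_pos hDK.le hCr₁.le hCr₃.le hε.le hM0 (by positivity : (0 : ℝ) ≤ 2 * π) hvolA hvolK hfK hfM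
    (n := J') (by simpa using hJ'lo)
  -- assemble
  have hsplit := kltl_lintegral_split_le (Icc θ₀ (θ₀ + 2 * π)) (C v') f
  refine hsplit.trans ((add_le_add hcoopInt hcausInt).trans ?_)
  rw [← ENNReal.ofReal_add (by positivity) (by positivity)]
  apply ENNReal.ofReal_le_ofReal
  -- the real-arithmetic: every term is `O(ε)` or `O(ε · number of scales)`
  have hsq1 : Real.sqrt (1 : ℝ) = 1 := Real.sqrt_one
  have hsqε : Real.sqrt ε ≤ 1 := by rw [← Real.sqrt_one]; exact Real.sqrt_le_sqrt hε1
  have hsqε0 : 0 ≤ Real.sqrt ε := Real.sqrt_nonneg _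
  have hεsq : Real.sqrt ε * Real.sqrt ε = ε := Real.mul_self_sqrt hε.le
  have htail1 : Real.sqrt (1 / 2 ^ J') ≤ Real.sqrt (2 * c₀) * Real.sqrt ε := by
    rw [← Real.sqrt_mul (by positivity)]
    exact Real.sqrt_le_sqrt (by linarith only [hJ'hi])
  have hT2 : 2 * π * K₁ * (v' / 2 ^ J) ≤ 2 * π * K₁ * ε := by gcongr
  have hT5 : (Ca₁ * ε + Ca₂ * Real.sqrt ε) * DK * Real.sqrt (1 / 2 ^ J') ≤
      DK * Real.sqrt (2 * c₀) * (Ca₁ + Ca₂) * ε := by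
    calc (Ca₁ * ε + Ca₂ * Real.sqrt ε) * DK * Real.sqrt (1 / 2 ^ J')
        ≤ (Ca₁ * ε + Ca₂ * Real.sqrt ε) * DK * (Real.sqrt (2 * c₀) * Real.sqrt ε) := by gcongr
      _ = DK * Real.sqrt (2 * c₀) * (Ca₁ * (ε * Real.sqrt ε) + Ca₂ * (Real.sqrt ε * Real.sqrt ε)) := by ring
      _ ≤ DK * Real.sqrt (2 * c₀) * (Ca₁ * ε + Ca₂ * ε) := by
          rw [hεsq]; gcongr; exact mul_le_of_le_one_right hε.le hsqε
      _ = DK * Real.sqrt (2 * c₀) * (Ca₁ + Ca₂) * ε := by ring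
  have hT1 : (J : ℝ) * (K₁ * (2 * Cc) * ε) ≤ κJ * L * (K₁ * (2 * Cc) * ε) := by
    gcongr; rw [hκJ]; exact hJle
  have hT4 : (J' : ℝ) * ((Cr₁ * DK * Real.sqrt 1 + Cr₃ * DK * Real.sqrt 2) * ε) ≤
      κJ' * L * ((Cr₁ * DK * Real.sqrt 1 + Cr₃ * DK * Real.sqrt 2) * ε) := by
    gcongr; rw [hκJ']; exact hJ'le
  have hLl : 1 ≤ L / Real.log 2 := by rw [le_div_iff₀ hl]; linarith
  rw [hsq1] at hT4 ⊢
  have hconst : 2 * π * K₁ * ε + (Cr₁ * ε + Cr₃ * ε / 1) * (2 * π) + DK * Real.sqrt (2 * c₀) * (Ca₁ + Ca₂) * ε ≤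
      (2 * π * K₁ + 2 * π * (Cr₁ + Cr₃) + DK * Real.sqrt (2 * c₀) * (Ca₁ + Ca₂)) / Real.log 2 * ε * L := by
    have h0 : 0 ≤ (2 * π * K₁ + 2 * π * (Cr₁ + Cr₃) + DK * Real.sqrt (2 * c₀) * (Ca₁ + Ca₂)) * ε := by positivity
    have h1 : 2 * π * K₁ * ε + (Cr₁ * ε + Cr₃ * ε / 1) * (2 * π) + DK * Real.sqrt (2 * c₀) * (Ca₁ + Ca₂) * ε =
        (2 * π * K₁ + 2 * π * (Cr₁ + Cr₃) + DK * Real.sqrt (2 * c₀) * (Ca₁ + Ca₂)) * ε := by ring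
    rw [h1]
    calc (2 * π * K₁ + 2 * π * (Cr₁ + Cr₃) + DK * Real.sqrt (2 * c₀) * (Ca₁ + Ca₂)) * ε
        = (2 * π * K₁ + 2 * π * (Cr₁ + Cr₃) + DK * Real.sqrt (2 * c₀) * (Ca₁ + Ca₂)) * ε * 1 := by ring
      _ ≤ (2 * π * K₁ + 2 * π * (Cr₁ + Cr₃) + DK * Real.sqrt (2 * c₀) * (Ca₁ + Ca₂)) * ε * (L / Real.log 2) := by
          gcongr
      _ = _ := by ring
  have hsum : J * (K₁ * (2 * Cc) * ε) + 2 * π * K₁ * (v' / 2 ^ J) +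
      ((Cr₁ * ε + Cr₃ * ε / 1) * (2 * π) + J' * ((Cr₁ * DK * 1 + Cr₃ * DK * Real.sqrt 2) * ε) +
        (Ca₁ * ε + Ca₂ * Real.sqrt ε) * DK * Real.sqrt (1 / 2 ^ J')) ≤ Q₁ * ε * L := by
    have hq : Q₁ * ε * L = κJ * L * (K₁ * (2 * Cc) * ε) + κJ' * L * ((Cr₁ * DK * 1 + Cr₃ * DK * Real.sqrt 2) * ε) +
        (2 * π * K₁ + 2 * π * (Cr₁ + Cr₃) + DK * Real.sqrt (2 * c₀) * (Ca₁ + Ca₂)) / Real.log 2 * ε * L := by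
      rw [hQ₁]; ring
    rw [hq]
    linarith
  have h6 : 0 ≤ Q₂ * ε * L := by positivity
  linarith [hsum, h6]

end Angular

end Summit.HubbardSuperconductivity.HubbardSuperconductivity.Theorems

end
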